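import Summits.AtomisticToContinuum.Crystallization.Theorems.ChartedPlanarOrderRigidityDoor
import Summits.AtomisticToContinuum.Crystallization.Theorems.ChartedPlanarOrderEnvelopeWalkSums
import Summits.AtomisticToContinuum.Crystallization.Theorems.FrustratedLawDichotomyPalmFrequency
import Summits.AtomisticToContinuum.Crystallization.Theorems.FrustratedLawDichotomyThickeningVacancyFloor
import Literature.Probability.Process.PointStationaryTransfer

/-!
# ChartedPlanarOrder · N `ChartedZeroExcessLayered` (stmt-AtomisticToContinuum-26636) — the MECKE HALF of lens-3's TRUE piece
# `SparseNull`: the unimodular window identity, modulo measurability of the matched-root event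
# (decomp-a2c, prover hand 1, generation 7; cell service for the «RigidityDoor» node of lens-3 g20, critic rows 353/356)

`ChartedPlanarOrderRigidityDoor.SparseNull ν` (landed text): for a point-stationary probability law a.s. carried by rooted `δ`-hard-core
configurations, if for every `ε > 0` there is a window radius `R > 0` with `windowBadFrac ν R μ ≤ ε` almost surely, then almost surely the
ROOT is `ν`-matched (`matchedAt ν μ 0`).  Here `windowBadFrac ν R μ = Σ_{p unmatched atom, dist p 0 ≤ R} 1/#(atoms in B̄_R(p))`.

This file proves it MODULO ONE MEASURABILITY INPUT — `MeasurableSet {μ | matchedAt ν μ 0}` — by mass transport: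

* `matchedAt_map_sub_of_matchedAt` — translation covariance of the matching predicate: an atom `y` matched in `μ` is a matched ROOT of the
  re-rooted configuration `θ_y μ = μ.map (· − y)` (the template is carried along; pure bookkeeping).
* `sparseNull_of_ae_measurable_version` ⊇ `sparseNull_of_nullMeasurableSet` ⊇ `sparseNull_of_measurable_version` ⊇ `sparseNull_of_measurableSet_matchedAt` —
  **an a.s. measurable version of the matched-root event at every atom / its NULL-measurability under each admissible law / a measurable version on
  rooted hard-core configurations / plain measurability ⟹ `SparseNull ν`.**  Transport
  `g(μ, y) = 𝟙{‖y‖ ≤ R} · 𝟙{θ_y μ unmatched} / max(1, #B̄_R(y))` (through the counting-measure kernel of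
  `FrustratedLawDichotomyFiniteClusterGapPrelude` for joint measurability): every finite partial sum of the OUT-flow is bounded by
  `windowBadFrac ν R μ ≤ ε` (`ChartedPlanarOrderEnvelopeTransport.lintegral_count_restrict_le_of_sum_le` (module `ChartedPlanarOrderEnvelopeWalkSums`)), while the IN-flow at the root is
  exactly `𝟙{root unmatched}` (the root's own window has `1 ≤ #B̄_R(0) < ∞` atoms, `FrustratedLawDichotomyPalmFrequency.count_closedBall_le`);
  the Mecke identity (`IsPointStationaryLaw`) gives `P(root unmatched) ≤ ε` for every `ε > 0`.

What is left of `SparseNull` for lens-3 is the measurability of the matched-root event (countable-net technique of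
`ChartedPlanarOrderDefectEventMeasurable`, `≤`-tolerance version).  No definitions, no `sorry`; `[folklore]` (mass-transport principle,
Aldous–Lyons 2007 §2; Last–Penrose 2017 §9.5 for the Mecke form).
-/

noncomputable section

namespace Summit.AtomisticToContinuum.Crystallization.Theorems.ChartedPlanarOrderSparseNullOfMeasurable

open MeasureTheory Metric Set Filter ProbabilityTheory
open scoped ENNReal
open Literature.Probability.Process
open Summit.AtomisticToContinuum.Crystallization.Theorems.ChartedPlanarOrderRigidityDoor
  (E3 matchedAt atomsIn badIn windowBadFrac SparseNull)
open Summit.AtomisticToContinuum.Crystallization.Theorems.FrustratedLawDichotomyFiniteClusterGap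
  (exists_kernel_eq_count_restrict measurable_kernel_map_sub ae_mem_of_sep)
open Summit.AtomisticToContinuum.Crystallization.Theorems.FrustratedLawDichotomyThinning (map_sub_map_sub_neg)
open Summit.AtomisticToContinuum.Crystallization.Theorems.FrustratedLawDichotomyPalmFrequency
  (count_closedBall_le one_le_apply_singleton_of_ne_zero map_sub_apply_singleton)
open Summit.AtomisticToContinuum.Crystallization.Theorems.ChartedPlanarOrderEnvelopeTransport (lintegral_count_restrict_le_of_sum_le)
open Summit.AtomisticToContinuum.Crystallization.Theorems.FrustratedLawDichotomyThickening (ae_shellFinite_of_hardCore)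

/-! ## §1. Translation covariance of `matchedAt` -/

/-- **Covariance of the matching predicate under re-rooting.**  If the point `y` is `ν`-matched in `μ`, then the root `0` is `ν`-matched in
the re-rooted configuration `θ_y μ = μ.map (· − y)` (same scale, frame, Hägg word and gaps; the template is translated by `−y`). [folklore] -/
theorem matchedAt_map_sub_of_matchedAt {ν : ℝ} {μ : Measure E3} {y : E3} (h : matchedAt ν μ y) :
    matchedAt ν (μ.map fun z : E3 => z - y) 0 := by
  obtain ⟨b, hb1, hb2, A, s, z, hs, hg, hz, h1, h2⟩ := h
  refine ⟨b, hb1, hb2, A, s, z, hs, hg, hz, fun p hp hpμ => ?_, fun p' hp' hd => ?_⟩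
  · -- configuration → template
    rw [map_sub_apply_singleton] at hpμ
    have hdist : dist (p + y) y ≤ 4 * b := by rwa [dist_eq_norm, add_sub_cancel_right, ← dist_zero_right]
    obtain ⟨y', hy', hd'⟩ := h1 (p + y) hdist hpμ
    refine ⟨y' - y, by rwa [sub_zero], ?_⟩
    rw [dist_eq_norm] at hd' ⊢
    have : p - (y' - y) = p + y - y' := by abel
    rwa [this]
  · -- template → configuration
    rw [sub_zero] at hp'
    have hdist : dist (p' + y) y ≤ 5 * b := by
      rw [dist_eq_norm, add_sub_cancel_right]
      rwa [dist_zero_right] at hd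
    obtain ⟨q, hq, hdq⟩ := h2 (p' + y) (by rwa [add_sub_cancel_right]) hdist
    refine ⟨q - y, ?_, ?_⟩
    · rwa [map_sub_apply_singleton, sub_add_cancel]
    · rw [dist_eq_norm] at hdq ⊢
      have : q - y - p' = q - (p' + y) := by abel
      rwa [this]

/-! ## §2. Counting atoms in a window -/

/-- For `μ = count|S` with `S` meeting `B̄_R(y)` in a finite set, `μ (B̄_R(y)) = #(atomsIn μ y R)`. [folklore] -/
theorem apply_closedBall_eq_ncard_atomsIn {S : Set E3} {y : E3} {R : ℝ} (hfin : (closedBall y R ∩ S).Finite) :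
    ((Measure.count : Measure E3).restrict S) (closedBall y R) =
      (Set.ncard (atomsIn ((Measure.count : Measure E3).restrict S) y R) : ℝ≥0∞) := by
  have hset : atomsIn ((Measure.count : Measure E3).restrict S) y R = closedBall y R ∩ S := by
    ext p
    simp only [atomsIn, mem_setOf_eq, count_restrict_singleton_ne_zero_iff, mem_inter_iff, mem_closedBall]
    tauto
  rw [hset, Measure.restrict_apply measurableSet_closedBall, Measure.count_apply_finite _ hfin,
    Set.ncard_eq_toFinset_card _ hfin]

/-! ## §3. The Mecke half of `SparseNull` -/

/-- **`SparseNull` modulo an ALMOST-SURE MEASURABLE VERSION of the matched-root event** (the weakest form): for each hard core `δ > 0` and each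
point-stationary probability law `P` a.s. carried by rooted `δ`-hard-core configurations it is enough to have a measurable set `M` of configurations
such that, `P`-almost surely, AT EVERY ATOM `y` the re-rooted configuration `θ_y μ` lies in `M` iff its root is `ν`-matched (the transport only
ever evaluates the event at re-rootings of `P`-typical configurations at their atoms). [folklore] -/
theorem sparseNull_of_ae_measurable_version (ν : ℝ)
    (hM : ∀ δ : ℝ, 0 < δ → ∀ P : Measure (Measure E3), IsProbabilityMeasure P →
      (∀ᵐ μ ∂P, IsRootedHardCore δ μ) → IsPointStationaryLaw P →
      ∃ M : Set (Measure E3), MeasurableSet M ∧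
        ∀ᵐ μ ∂P, ∀ y : E3, μ {y} ≠ 0 →
          ((μ.map fun z : E3 => z - y) ∈ M ↔ matchedAt ν (μ.map fun z : E3 => z - y) 0)) :
    SparseNull ν := by
  classical
  intro δ hδ P hP hcore hstat hwin
  obtain ⟨M, hMm, hMiff⟩ := hM δ hδ P hP hcore hstat
  -- it suffices to show `P Mᶜ ≤ ε` for every `ε > 0`
  suffices hzero : P Mᶜ = 0 by
    have : ∀ᵐ μ ∂P, μ ∉ Mᶜ := measure_eq_zero_iff_ae_notMem.1 hzero
    filter_upwards [this, hcore, hMiff] with μ hμ hμc hiff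
    obtain ⟨S, h0, -, rfl⟩ := hμc
    have h := (hiff 0 ((count_restrict_singleton_ne_zero_iff S 0).2 h0)).1
    simp only [sub_zero, Measure.map_id'] at h
    exact h (not_notMem.1 hμ)
  refine le_antisymm (ENNReal.le_of_forall_pos_le_add fun ε hε _ => ?_) bot_le
  rw [zero_add]
  obtain ⟨R, hRpos, hR⟩ := hwin ε (by exact_mod_cast hε)
  -- the counting-measure kernel (joint measurability of re-rooting)
  obtain ⟨κ, hκs, hκS⟩ := exists_kernel_eq_count_restrict hδ
  have hκ : ∀ μ : Measure E3, IsRootedHardCore δ μ → κ μ = μ := by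
    rintro μ ⟨S, -, hsep, rfl⟩; exact hκS S hsep
  obtain ⟨C, hC⟩ := count_closedBall_le hδ R
  -- selection `Sel = {(μ, y) : ‖y‖ ≤ R, θ_y (κ μ) unmatched}` and weight `w (μ, y) = #atoms of κ μ in B̄_R(y)`
  set Sel : Set (Measure E3 × E3) := {q | ‖q.2‖ ≤ R ∧ (κ q.1).map (fun z : E3 => z - q.2) ∈ Mᶜ} with hSel
  have hSelm : MeasurableSet Sel :=
    (measurableSet_le measurable_snd.norm measurable_const).inter ((measurable_kernel_map_sub κ) hMm.compl)
  set w : Measure E3 × E3 → ℝ≥0∞ := fun q => ((κ q.1).map (fun z : E3 => z - q.2)) (closedBall (0 : E3) R) with hw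
  have hwm : Measurable w := (Measure.measurable_coe measurableSet_closedBall).comp (measurable_kernel_map_sub κ)
  -- re-rooted window: `(θ_y μ)(B̄_R(0)) = μ (B̄_R(y))`
  have hmapball : ∀ (μ : Measure E3) (y : E3), (μ.map fun z : E3 => z - y) (closedBall (0 : E3) R) = μ (closedBall y R) := by
    intro μ y
    rw [Measure.map_apply (measurable_sub_const y) measurableSet_closedBall]
    congr 1
    ext z
    simp [mem_closedBall, dist_eq_norm]
  have hwμ : ∀ μ : Measure E3, IsRootedHardCore δ μ → ∀ y : E3, w (μ, y) = μ (closedBall y R) := fun μ hμ y => by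
    simp only [hw, hκ μ hμ, hmapball]
  -- the transport
  set g : Measure E3 → E3 → ℝ≥0∞ := fun μ y => Sel.indicator 1 (μ, y) * (max 1 (w (μ, y)))⁻¹ with hg
  have hgm : Measurable (Function.uncurry g) := by
    have h1 : Measurable fun q : Measure E3 × E3 => Sel.indicator (1 : Measure E3 × E3 → ℝ≥0∞) q :=
      measurable_one.indicator hSelm
    exact h1.mul (measurable_const.max hwm).inv
  have key := hstat g hgm
  -- OUT-flow: every finite partial sum is bounded by `windowBadFrac ν R μ ≤ ε`
  have hout : ∀ᵐ μ ∂P, ∫⁻ y, g μ y ∂μ ≤ ENNReal.ofReal ε := by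
    filter_upwards [hcore, hR, hMiff] with μ hμ hRμ hiff
    have hμ' := hμ
    obtain ⟨S, h0, hsep, rfl⟩ := hμ
    have hSm : MeasurableSet S := (LocalConfig.isClosed_of_separated hδ hsep).measurableSet
    -- the finite set of unmatched atoms of the root's window and its weights
    set B : Set E3 := badIn ν ((Measure.count : Measure E3).restrict S) (atomsIn ((Measure.count : Measure E3).restrict S) 0 R) with hB
    have hBsub : B ⊆ closedBall (0 : E3) R ∩ S := by
      intro p hp
      simp only [hB, badIn, atomsIn, mem_setOf_eq, count_restrict_singleton_ne_zero_iff] at hp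
      exact ⟨mem_closedBall.2 hp.1.2, hp.1.1⟩
    have hBfin : B.Finite := (LocalConfig.finite_inter_of_separated hδ hsep (isCompact_closedBall (0 : E3) R)).subset hBsub
    set wt : E3 → ℝ := fun p => (1 : ℝ) / (Set.ncard (atomsIn ((Measure.count : Measure E3).restrict S) p R) : ℝ) with hwt
    have hwt0 : ∀ p, 0 ≤ wt p := fun p => by simp only [hwt]; positivity
    have hfrac : windowBadFrac ν R ((Measure.count : Measure E3).restrict S) = ∑ p ∈ hBfin.toFinset, wt p := by
      simp only [windowBadFrac, ← hB]
      exact finsum_mem_eq_finite_toFinset_sum _ hBfin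
    have hε' : ENNReal.ofReal (windowBadFrac ν R ((Measure.count : Measure E3).restrict S)) ≤ ENNReal.ofReal ε :=
      ENNReal.ofReal_le_ofReal hRμ
    refine le_trans ?_ hε'
    rw [hfrac, ENNReal.ofReal_sum_of_nonneg (fun p _ => hwt0 p)]
    refine lintegral_count_restrict_le_of_sum_le hSm fun T hT => ?_
    -- compare the partial sum over `T ⊆ S` with the sum over `B` termwise
    have hterm : ∀ y ∈ T, g ((Measure.count : Measure E3).restrict S) y ≠ 0 →
        y ∈ hBfin.toFinset ∧ g ((Measure.count : Measure E3).restrict S) y ≤ ENNReal.ofReal (wt y) := by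
      intro y hyT hgy
      have hyS : y ∈ S := hT y hyT
      have hsel : (((Measure.count : Measure E3).restrict S), y) ∈ Sel := by
        by_contra hns
        exact hgy (by simp only [hg, indicator_of_notMem hns, zero_mul])
      have hsel' : ‖y‖ ≤ R ∧ (((Measure.count : Measure E3).restrict S).map fun z : E3 => z - y) ∉ M := by
        simpa only [hSel, mem_setOf_eq, hκ _ hμ', mem_compl_iff] using hsel
      have hbad : ¬ matchedAt ν ((Measure.count : Measure E3).restrict S) y :=
        fun hm => hsel'.2 ((hiff y ((count_restrict_singleton_ne_zero_iff S y).2 hyS)).2 (matchedAt_map_sub_of_matchedAt hm))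
      have hyB : y ∈ B := by
        simp only [hB, badIn, atomsIn, mem_setOf_eq, count_restrict_singleton_ne_zero_iff]
        exact ⟨⟨hyS, by rw [dist_zero_right]; exact hsel'.1⟩, hbad⟩
      refine ⟨hBfin.mem_toFinset.2 hyB, ?_⟩
      -- the weight: `(max 1 #B̄_R(y))⁻¹ = 1 / #atomsIn y R`
      have hfinY : (closedBall y R ∩ S).Finite := LocalConfig.finite_inter_of_separated hδ hsep (isCompact_closedBall y R)
      have hcnt := apply_closedBall_eq_ncard_atomsIn (y := y) (R := R) hfinY
      have hn1 : 1 ≤ Set.ncard (atomsIn ((Measure.count : Measure E3).restrict S) y R) := by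
        rw [Nat.one_le_iff_ne_zero, ← Nat.pos_iff_ne_zero, Set.ncard_pos (hfinY.subset ?_)]
        · exact ⟨y, (count_restrict_singleton_ne_zero_iff S y).2 hyS, by
            simp only [dist_self]; exact le_trans (norm_nonneg y) hsel'.1⟩
        · intro p hp
          simp only [atomsIn, mem_setOf_eq, count_restrict_singleton_ne_zero_iff] at hp
          exact ⟨mem_closedBall.2 hp.2, hp.1⟩
      have hle1 : g ((Measure.count : Measure E3).restrict S) y ≤ (max 1 (w (((Measure.count : Measure E3).restrict S), y)))⁻¹ := by
        simp only [hg, indicator_of_mem hsel, Pi.one_apply, one_mul, le_refl]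
      refine hle1.trans (le_of_eq ?_)
      show (max 1 (w (((Measure.count : Measure E3).restrict S), y)))⁻¹ =
        ENNReal.ofReal ((1 : ℝ) / (Set.ncard (atomsIn ((Measure.count : Measure E3).restrict S) y R) : ℝ))
      have hpos : (0 : ℝ) < (Set.ncard (atomsIn ((Measure.count : Measure E3).restrict S) y R) : ℝ) := by exact_mod_cast hn1
      rw [hwμ _ hμ', hcnt, max_eq_right (by exact_mod_cast hn1), one_div, ENNReal.ofReal_inv_of_pos hpos, ENNReal.ofReal_natCast]
    calc ∑ y ∈ T, g ((Measure.count : Measure E3).restrict S) y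
        = ∑ y ∈ T.filter (fun y => g ((Measure.count : Measure E3).restrict S) y ≠ 0), g ((Measure.count : Measure E3).restrict S) y :=
          (Finset.sum_filter_ne_zero _).symm
      _ ≤ ∑ y ∈ T.filter (fun y => g ((Measure.count : Measure E3).restrict S) y ≠ 0), ENNReal.ofReal (wt y) :=
          Finset.sum_le_sum fun y hy => (hterm y (Finset.mem_filter.1 hy).1 (Finset.mem_filter.1 hy).2).2
      _ ≤ ∑ p ∈ hBfin.toFinset, ENNReal.ofReal (wt p) :=
          Finset.sum_le_sum_of_subset fun y hy => (hterm y (Finset.mem_filter.1 hy).1 (Finset.mem_filter.1 hy).2).1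
  -- IN-flow at the root: exactly `𝟙{root unmatched}`
  have hin : ∀ᵐ μ ∂P, Mᶜ.indicator 1 μ ≤ ∫⁻ y, g (μ.map fun z : E3 => z - y) (-y) ∂μ := by
    filter_upwards [hcore] with μ hμ
    by_cases hμM : μ ∈ Mᶜ
    swap
    · rw [indicator_of_notMem hμM]; exact bot_le
    rw [indicator_of_mem hμM, Pi.one_apply]
    have hμ' := hμ
    obtain ⟨S, h0, hsep, rfl⟩ := hμ
    set μS : Measure E3 := (Measure.count : Measure E3).restrict S with hμS
    -- the integrand at every atom `y`
    have hpt : ∀ᵐ y ∂μS, (closedBall (0 : E3) R).indicator 1 y * (max 1 (μS (closedBall (0 : E3) R)))⁻¹ ≤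
        g (μS.map fun z : E3 => z - y) (-y) := by
      refine (ae_mem_of_sep hδ hsep).mono fun y hy => ?_
      have hy' : μS {y} ≠ 0 := (count_restrict_singleton_ne_zero_iff S y).2 hy
      have hθ : IsRootedHardCore δ (μS.map fun z : E3 => z - y) := hμ'.map_sub hy'
      by_cases hyR : y ∈ closedBall (0 : E3) R
      · have hsel : ((μS.map fun z : E3 => z - y), -y) ∈ Sel := by
          simp only [hSel, mem_setOf_eq, hκ _ hθ, map_sub_map_sub_neg, norm_neg]
          exact ⟨mem_closedBall_zero_iff.1 hyR, hμM⟩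
        have hwv : w ((μS.map fun z : E3 => z - y), -y) = μS (closedBall (0 : E3) R) := by
          simp only [hw, hκ _ hθ, map_sub_map_sub_neg]
        simp only [hg, indicator_of_mem hsel, indicator_of_mem hyR, Pi.one_apply, one_mul, hwv, le_refl]
      · simp only [indicator_of_notMem hyR, zero_mul]; exact bot_le
    refine le_trans (le_of_eq ?_) (lintegral_mono_ae hpt)
    rw [lintegral_mul_const _ (measurable_one.indicator measurableSet_closedBall), lintegral_indicator_one measurableSet_closedBall]
    have hN1 : 1 ≤ μS (closedBall (0 : E3) R) :=
      (one_le_apply_singleton_of_ne_zero hμ' ((count_restrict_singleton_ne_zero_iff S 0).2 h0)).trans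
        (measure_mono (singleton_subset_iff.2 (mem_closedBall_self hRpos.le)))
    have hNtop : μS (closedBall (0 : E3) R) ≠ ∞ := ne_top_of_le_ne_top (ENNReal.natCast_ne_top C) (hC μS hμ')
    rw [max_eq_right hN1, ENNReal.mul_inv_cancel (ne_of_gt (lt_of_lt_of_le zero_lt_one hN1)) hNtop]
  -- the Mecke identity
  calc P Mᶜ = ∫⁻ μ, Mᶜ.indicator 1 μ ∂P := (lintegral_indicator_one hMm.compl).symm
    _ ≤ ∫⁻ μ, ∫⁻ y, g (μ.map fun z : E3 => z - y) (-y) ∂μ ∂P := lintegral_mono_ae hin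
    _ = ∫⁻ μ, ∫⁻ y, g μ y ∂μ ∂P := key.symm
    _ ≤ ∫⁻ μ, ENNReal.ofReal ε ∂P := lintegral_mono_ae hout
    _ = (ε : ℝ≥0∞) := by rw [lintegral_const, measure_univ, mul_one, ENNReal.ofReal_coe_nnreal]

/-- **`SparseNull` modulo NULL-measurability of the matched-root event** under each admissible law (the shape delivered by the countable-net
technique of `ChartedPlanarOrderDefectEventMeasurable.defectEventNullMeasurable`): a measurable `P`-a.e. version of the event is transported to
EVERY atom by the Aldous–Lyons transfer `IsPointStationaryLaw.ae_forall_map_sub` (a `P`-null set is seen from no atom). [folklore] -/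
theorem sparseNull_of_nullMeasurableSet (ν : ℝ)
    (hN : ∀ δ : ℝ, 0 < δ → ∀ P : Measure (Measure E3), IsProbabilityMeasure P →
      (∀ᵐ μ ∂P, IsRootedHardCore δ μ) → IsPointStationaryLaw P →
      NullMeasurableSet {μ : Measure E3 | matchedAt ν μ 0} P) : SparseNull ν := by
  refine sparseNull_of_ae_measurable_version ν fun δ hδ P hP hcore hstat => ?_
  obtain ⟨t, -, htm, hteq⟩ := (hN δ hδ P hP hcore hstat).exists_measurable_superset_ae_eq
  refine ⟨t, htm, ?_⟩
  have hp : ∀ᵐ μ ∂P, (μ ∈ t ↔ matchedAt ν μ 0) := by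
    filter_upwards [hteq.mem_iff] with μ hμ
    simpa only [mem_setOf_eq] using hμ
  exact hstat.ae_forall_map_sub (ae_shellFinite_of_hardCore hδ hcore) hp

/-- **`SparseNull` modulo a MEASURABLE VERSION of the matched-root event on hard-core configurations**: for each hard core `δ > 0`, a measurable
set of configurations that agrees with `{μ | matchedAt ν μ 0}` on the rooted `δ`-hard-core ones suffices (re-rootings at atoms stay rooted
`δ`-hard-core, `IsRootedHardCore.map_sub`). [folklore] -/
theorem sparseNull_of_measurable_version (ν : ℝ)
    (hM : ∀ δ : ℝ, 0 < δ → ∃ M : Set (Measure E3), MeasurableSet M ∧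
      ∀ μ : Measure E3, IsRootedHardCore δ μ → (μ ∈ M ↔ matchedAt ν μ 0)) : SparseNull ν := by
  refine sparseNull_of_ae_measurable_version ν fun δ hδ P _ hcore _ => ?_
  obtain ⟨M, hMm, hMiff⟩ := hM δ hδ
  refine ⟨M, hMm, ?_⟩
  filter_upwards [hcore] with μ hμ y hy
  exact hMiff _ (hμ.map_sub hy)

/-- **`SparseNull` modulo measurability of the matched-root event** (the plain form: `{μ | matchedAt ν μ 0}` measurable in the space of all
measures). [folklore] -/
theorem sparseNull_of_measurableSet_matchedAt (ν : ℝ)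
    (hM : MeasurableSet {μ : Measure E3 | matchedAt ν μ 0}) : SparseNull ν :=
  sparseNull_of_measurable_version ν fun _ _ => ⟨_, hM, fun _ _ => Iff.rfl⟩

end Summit.AtomisticToContinuum.Crystallization.Theorems.ChartedPlanarOrderSparseNullOfMeasurable

end
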